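import Literature.NumberTheory.QuadraticFields.ScholzHeckeUnitCubeOfCongruence
import Literature.NumberTheory.NumberFields.KummerCubeRootUnramifiedConverse
import Literature.NumberTheory.NumberFields.SqrtGeneratorUnramified
import Mathlib.NumberTheory.RamificationInertia.Basic
import Mathlib.NumberTheory.RamificationInertia.Unramified
import HarnessLib

/-!
# Scholz–Hecke unit criterion, direction (ii), tail: `M(∛ε)/M` unramified above `3` ⇒ `UnitCubeAtThree d`

Topic `NumberTheory/QuadraticFields`.  Theorem-only file (no definition, no named fact), part of
the proof of `ScholzHecke_unitCubeCriterion` (`ScholzHeckeUnitCriterion.lean`).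

Setting (as in `ScholzHeckeUnitCriterionProofs.lean`): `−d < 0` a fundamental discriminant, `d ≠ 3`,
`K = ℚ(δ)`, `δ² = −d`, `M ⊇ K` quadratic containing `λ` (`λ² = −3`), `d₀ = mirrorRadicand d`,
`3d = d₀c₀²`, `(a, b)` the pair of `IsMirrorFundUnit d a b` and
`ε = a/2 + (b/2c₀)·δλ = (a + b√d₀)/2 ∈ 𝓞_Mˣ`.  Let `N ⊇ M` be a number field containing `y` with
`y³ = ε`.

* `unitCubeAtThree_of_isUnramifiedAt` — **if every prime of `𝓞_N` is unramified over `𝓞_M`, then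
  `UnitCubeAtThree d`.**  This is Hecke's theorem 119 (necessity of `ε ≡ ξ³ (mod 𝔩³)` for
  `M(∛ε)/M` to be unramified at `𝔩 ∣ 3`; tree file `KummerCubeRootUnramifiedConverse.lean`) turned
  into the congruences of `UnitCubeAtThree`:
  for every prime `𝔓 ∋ λ` of `𝓞_M` one gets `ε ≡ ξ³ (mod 𝔓³)`, hence `ε^{q−1} ≡ 1 (mod 𝔓³)`
  (`pow_sub_one_sub_one_mem_pow_three`) with `q = N𝔓 ∈ {3, 9}` (`natCard_quot_eq_three_or_nine`:
  `e(𝔓|3) ≥ 2` and `e·f ≤ [M:ℚ] = 4`), so `ε⁸ ≡ 1 (mod 𝔓³)` for all `𝔓 ∣ 3`; since `3` has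
  ramification index exactly `2` in `M` (`three_not_mem_pow_three`: one of the layers `K/ℚ`,
  `M/K` is unramified at `3`, by `SqrtGeneratorUnramified.lean` applied to `δ` resp. `√d₀`), the
  ideal `(λ)` is the product of the distinct primes above `3` and `ε⁸ − 1 ∈ ∏ 𝔓³ = (λ)³`
  (`exists_eq_pow_three_mul`); finally `ScholzHeckeUnitCubeOfCongruence.lean`
  (`unitCubeAtThree_of_pow_eight_sub_one_eq`, with the conjugation `λ ↦ −λ` of `M/K`) translates
  `ε⁸ ≡ 1 (mod λ³)` into `X ≡ 4 (mod 9)`, `9 ∣ Y` resp. `3 ∣ Y`.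

## References

* E. Hecke, *Lectures on the Theory of Algebraic Numbers*, GTM 77, Springer 1981, §39, Thm. 119.
  [Hecke1981]
* L. C. Washington, *Introduction to Cyclotomic Fields*, GTM 83 (2nd ed. 1997), Thm. 10.10 and
  its proof. [Washington1997]
* A. Scholz, *Über die Beziehung der Klassenzahlen quadratischer Körper zueinander*, J. reine
  angew. Math. 166 (1932), 201–203. [Scholz1932]
-/

noncomputable section

open NumberField Module Ideal IntermediateField Polynomial UniqueFactorizationMonoid

namespace Literature.NumberTheory.QuadraticFields

namespace ScholzHecke

open Literature.NumberTheory.NumberFields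

/-! ### Ramification of `3` in a quadratic tower -/

/-- The prime of `ℤ` below a prime containing `3` is `(3)`. [folklore] -/
theorem under_int_eq_span_three {R : Type*} [CommRing R] (P : Ideal R) [hP : P.IsPrime]
    (h3 : (3 : R) ∈ P) : P.under ℤ = Ideal.span {(3 : ℤ)} := by
  have hmax : (Ideal.span {(3 : ℤ)}).IsMaximal :=
    PrincipalIdealRing.isMaximal_of_irreducible Int.prime_three.irreducible
  refine (hmax.eq_of_le (Ideal.IsPrime.under ℤ P).ne_top ?_).symm
  rw [Ideal.span_singleton_le_iff_mem, Ideal.under_def, Ideal.mem_comap, map_ofNat]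
  exact h3

/-- **`v_𝔓(3) ≤ 2` in a quadratic tower unramified at `3` in one of its two layers.**  Let
`ℚ ⊆ K ⊆ M` be number fields with `[K : ℚ] = [M : K] = 2`, and assume that either every prime
of `K` above `3` is unramified over `ℤ`, or every prime of `M` above `3` is unramified over `𝓞_K`.
Then `3 ∉ 𝔓³` for every prime `𝔓` of `𝓞_M` above `3`: `v_𝔓(3) = e(𝔓|𝔭)·e(𝔭|3) ≤ 2`.
[folklore] -/
theorem three_not_mem_pow_three {K M : Type*} [Field K] [NumberField K] [Field M] [NumberField M]
    [Algebra K M] (h2 : finrank ℚ K = 2) (hKM : finrank K M = 2)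
    (hunr : (∀ (𝔭 : Ideal (𝓞 K)) [𝔭.IsMaximal], (3 : 𝓞 K) ∈ 𝔭 → Algebra.IsUnramifiedAt ℤ 𝔭) ∨
      (∀ (𝔓 : Ideal (𝓞 M)) [𝔓.IsMaximal], (3 : 𝓞 M) ∈ 𝔓 → Algebra.IsUnramifiedAt (𝓞 K) 𝔓))
    (𝔓 : Ideal (𝓞 M)) [𝔓.IsMaximal] (h3 : (3 : 𝓞 M) ∈ 𝔓) : (3 : 𝓞 M) ∉ 𝔓 ^ 3 := by
  classical
  haveI := Literature.NumberTheory.NumberFields.noZeroSMulDivisors_ringOfIntegers (F := K) (E := M)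
  haveI h𝔓prime : 𝔓.IsPrime := Ideal.IsMaximal.isPrime inferInstance
  -- the primes below `𝔓`
  obtain ⟨𝔭, h𝔭def⟩ : ∃ 𝔭 : Ideal (𝓞 K), 𝔭 = 𝔓.under (𝓞 K) := ⟨_, rfl⟩
  haveI : 𝔭.IsMaximal := h𝔭def ▸ Ideal.IsMaximal.under (𝓞 K) 𝔓
  haveI h𝔭prime : 𝔭.IsPrime := Ideal.IsMaximal.isPrime inferInstance
  haveI : 𝔓.LiesOver 𝔭 := ⟨h𝔭def⟩
  have h3𝔭 : (3 : 𝓞 K) ∈ 𝔭 := by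
    rw [h𝔭def, Ideal.under_def, Ideal.mem_comap, map_ofNat]; exact h3
  have h𝔭3 : 𝔭.under ℤ = span {(3 : ℤ)} := under_int_eq_span_three 𝔭 h3𝔭
  haveI : 𝔭.LiesOver (span {(3 : ℤ)}) := ⟨h𝔭3.symm⟩
  haveI hp3max : (span {(3 : ℤ)} : Ideal ℤ).IsMaximal :=
    PrincipalIdealRing.isMaximal_of_irreducible Int.prime_three.irreducible
  have hp30 : (span {(3 : ℤ)} : Ideal ℤ) ≠ ⊥ := by simp
  have h𝔭0 : 𝔭 ≠ ⊥ := fun h => by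
    rw [h, Ideal.mem_bot] at h3𝔭; exact (by norm_num : (3 : 𝓞 K) ≠ 0) h3𝔭
  have h𝔓0 : 𝔓 ≠ ⊥ := fun h => by
    rw [h, Ideal.mem_bot] at h3; exact (by norm_num : (3 : 𝓞 M) ≠ 0) h3
  -- the two ramification indices, each `≤ 2`, one of them `= 1`
  have he₁ : (span {(3 : ℤ)}).ramificationIdx' 𝔭 ≤ 2 := by
    have := Ideal.ramificationIdx_le_finrank (𝓞 K) ℚ K 𝔭 (p := span {(3 : ℤ)})
    rwa [h2] at this
  have he₂ : 𝔭.ramificationIdx' 𝔓 ≤ 2 := by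
    have := Ideal.ramificationIdx_le_finrank (𝓞 M) K M 𝔓 (p := 𝔭)
    rwa [hKM] at this
  have hprod : 𝔭.ramificationIdx' 𝔓 * (span {(3 : ℤ)}).ramificationIdx' 𝔭 ≤ 2 := by
    rcases hunr with hK | hM
    · have h1 : (span {(3 : ℤ)}).ramificationIdx' 𝔭 = 1 := by
        haveI := hK 𝔭 h3𝔭
        rw [Ideal.ramificationIdx'_eq_ramificationIdx _ 𝔭 hp30]
        exact Ideal.ramificationIdx_eq_one_of_isUnramifiedAt
      rw [h1, mul_one]; exact he₂
    · have h1 : 𝔭.ramificationIdx' 𝔓 = 1 := by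
        haveI := hM 𝔓 h3
        rw [Ideal.ramificationIdx'_eq_ramificationIdx 𝔭 𝔓 h𝔭0]
        exact Ideal.ramificationIdx_eq_one_of_isUnramifiedAt
      rw [h1, one_mul]; exact he₁
  -- multiplicities: `v_𝔭(3) = e(𝔭|3)`, `v_𝔓(3) = e(𝔓|𝔭) · v_𝔭(3)`
  have hirr𝔭 : Irreducible 𝔭 := (Ideal.prime_of_isPrime h𝔭0 inferInstance).irreducible
  have hirr𝔓 : Irreducible 𝔓 := (Ideal.prime_of_isPrime h𝔓0 inferInstance).irreducible
  have hprime3 : Prime (span {(3 : ℤ)} : Ideal ℤ) := Ideal.prime_of_isPrime hp30 hp3max.isPrime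
  have hv𝔭 : emultiplicity 𝔭 (span {(3 : 𝓞 K)}) = (span {(3 : ℤ)}).ramificationIdx' 𝔭 := by
    have := Ideal.IsDedekindDomain.emultiplicity_map_eq_ramificationIdx'_mul (R := ℤ) (S := 𝓞 K)
      (I := span {(3 : ℤ)}) hp30 hprime3.irreducible hirr𝔭 h𝔭0
    rw [Ideal.map_span, Set.image_singleton, map_ofNat] at this
    rw [this, (FiniteMultiplicity.of_prime_left hprime3 hp30).emultiplicity_self, mul_one]
  have hI0 : (span {(3 : 𝓞 K)} : Ideal (𝓞 K)) ≠ ⊥ := by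
    rw [Ne, Ideal.span_singleton_eq_bot]; norm_num
  have hv𝔓 : emultiplicity 𝔓 (span {(3 : 𝓞 M)}) =
      ((𝔭.ramificationIdx' 𝔓 * (span {(3 : ℤ)}).ramificationIdx' 𝔭 : ℕ) : ℕ∞) := by
    have := Ideal.IsDedekindDomain.emultiplicity_map_eq_ramificationIdx'_mul (R := 𝓞 K) (S := 𝓞 M)
      (I := span {(3 : 𝓞 K)}) hI0 hirr𝔭 hirr𝔓 h𝔓0
    rw [Ideal.map_span, Set.image_singleton, map_ofNat] at this
    rw [this, hv𝔭, Nat.cast_mul]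
  -- conclude: `3 ∈ 𝔓³` would give `3 ≤ v_𝔓(3) ≤ 2`
  intro hmem
  have hle : ((3 : ℕ) : ℕ∞) ≤ emultiplicity 𝔓 (span {(3 : 𝓞 M)}) := by
    rw [← pow_dvd_iff_le_emultiplicity, Ideal.dvd_span_singleton]; exact hmem
  rw [hv𝔓, Nat.cast_le] at hle
  omega

/-- **The residue fields above `3` of a quartic field in which `3` ramifies have `3` or `9`
elements.**  Let `ℚ ⊆ K ⊆ M` with `[K : ℚ] = [M : K] = 2` and `𝔓` a prime of `𝓞_M` with `3 ∈ 𝔓²`.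
Then `e(𝔓|3) ≥ 2` and `e·f ≤ [M : ℚ] = 4` give `f ≤ 2`, i.e. `#𝓞_M/𝔓 ∈ {3, 9}`. [folklore] -/
theorem natCard_quot_eq_three_or_nine {K M : Type*} [Field K] [NumberField K] [Field M]
    [NumberField M] [Algebra K M] (h2 : finrank ℚ K = 2) (hKM : finrank K M = 2)
    (𝔓 : Ideal (𝓞 M)) [𝔓.IsMaximal] (h3 : (3 : 𝓞 M) ∈ 𝔓 ^ 2) :
    Nat.card (𝓞 M ⧸ 𝔓) = 3 ∨ Nat.card (𝓞 M ⧸ 𝔓) = 9 := by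
  classical
  have h3P : (3 : 𝓞 M) ∈ 𝔓 := Ideal.pow_le_self two_ne_zero h3
  haveI h𝔓prime : 𝔓.IsPrime := Ideal.IsMaximal.isPrime inferInstance
  have h𝔓3 : 𝔓.under ℤ = span {(3 : ℤ)} := under_int_eq_span_three 𝔓 h3P
  haveI h𝔓over : 𝔓.LiesOver (span {(3 : ℤ)}) := ⟨h𝔓3.symm⟩
  haveI hp3max : (span {(3 : ℤ)} : Ideal ℤ).IsMaximal :=
    PrincipalIdealRing.isMaximal_of_irreducible Int.prime_three.irreducible
  have hp30 : (span {(3 : ℤ)} : Ideal ℤ) ≠ ⊥ := by simp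
  have hmaple : map (algebraMap ℤ (𝓞 M)) (span {(3 : ℤ)}) ≤ 𝔓 := by
    rw [Ideal.map_span, Set.image_singleton, map_ofNat, Ideal.span_singleton_le_iff_mem]; exact h3P
  -- `e ≥ 2`
  have he2 : 2 ≤ 𝔓.ramificationIdx ℤ := by
    rw [← Ideal.ramificationIdx'_eq_ramificationIdx (span {(3 : ℤ)}) 𝔓 hp30]
    have hne1 : (span {(3 : ℤ)}).ramificationIdx' 𝔓 ≠ 1 := by
      rw [Ideal.ramificationIdx'_ne_one_iff hmaple, Ideal.map_span, Set.image_singleton, map_ofNat,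
        Ideal.span_singleton_le_iff_mem]
      exact h3
    have hne0 : (span {(3 : ℤ)}).ramificationIdx' 𝔓 ≠ 0 := by
      rw [Ideal.ramificationIdx'_eq_ramificationIdx (span {(3 : ℤ)}) 𝔓 hp30]
      exact (Ideal.ramificationIdx_pos 𝔓 ℤ).ne'
    omega
  -- `e · f ≤ [M : ℚ] = 4`
  have hsum := Ideal.sum_ramification_inertia_eq_finrank (R := ℤ) (S := 𝓞 M) (p := span {(3 : ℤ)})
  rw [RingOfIntegers.rank, ← finrank_mul_finrank ℚ K M, h2, hKM] at hsum
  have hef : 𝔓.ramificationIdx ℤ * 𝔓.inertiaDeg ℤ ≤ 4 := by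
    have := Finset.single_le_sum
      (f := fun q : (span {(3 : ℤ)}).primesOver (𝓞 M) => q.1.ramificationIdx ℤ * q.1.inertiaDeg ℤ)
      (fun _ _ => Nat.zero_le _) (Finset.mem_univ ⟨𝔓, h𝔓prime, h𝔓over⟩)
    rw [hsum] at this
    simpa using this
  have hf : 𝔓.inertiaDeg ℤ ≤ 2 := by
    by_contra hf
    push Not at hf
    have : 2 * 3 ≤ 𝔓.ramificationIdx ℤ * 𝔓.inertiaDeg ℤ := Nat.mul_le_mul he2 hf
    omega
  have hfpos : 0 < 𝔓.inertiaDeg ℤ := Ideal.inertiaDeg_pos 𝔓 ℤ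
  -- `#𝓞_M/𝔓 = 3^f`
  have hcard : Nat.card (𝓞 M ⧸ 𝔓) = 3 ^ 𝔓.inertiaDeg ℤ := by
    rw [← Submodule.cardQuot_apply, ← Ideal.absNorm_apply, pow_inertiaDeg 3 𝔓]
  rw [hcard]
  interval_cases (𝔓.inertiaDeg ℤ) <;> simp

/-! ### From `z ∈ 𝔓³` for all `𝔓 ∋ l` (with `(l)` squarefree) to `l³ ∣ z` -/

/-- **Local-to-global for a squarefree principal ideal.**  In a Dedekind domain let `l ≠ 0` with
`l ∉ 𝔓²` for every maximal `𝔓` (i.e. `(l)` squarefree), and let `z ∈ 𝔓³` for every maximal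
`𝔓 ∋ l`.  Then `z = l³ w` for some `w`: compare the prime factorisations of `(l)³` and `(z)`.
[folklore] -/
theorem exists_eq_pow_three_mul {R : Type*} [CommRing R] [IsDedekindDomain R] {l z : R}
    (hl : l ≠ 0) (hsq : ∀ (P : Ideal R) [P.IsMaximal], l ∉ P ^ 2)
    (hz : ∀ (P : Ideal R) [P.IsMaximal], l ∈ P → z ∈ P ^ 3) : ∃ w : R, z = l ^ 3 * w := by
  classical
  by_cases hz0 : z = 0
  · exact ⟨0, by simp [hz0]⟩
  have hl' : (span {l} : Ideal R) ≠ ⊥ := by rwa [Ne, Ideal.span_singleton_eq_bot]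
  have hl3 : (span {l} : Ideal R) ^ 3 ≠ ⊥ := pow_ne_zero 3 hl'
  have hz' : (span {z} : Ideal R) ≠ ⊥ := by rwa [Ne, Ideal.span_singleton_eq_bot]
  suffices h : (span {l} : Ideal R) ^ 3 ∣ span {z} by
    rw [Ideal.span_singleton_pow] at h
    have hzm : z ∈ span {l ^ 3} := (Ideal.le_of_dvd h) (Ideal.mem_span_singleton_self z)
    obtain ⟨w, hw⟩ := Ideal.mem_span_singleton'.mp hzm
    exact ⟨w, by rw [← hw, mul_comm]⟩
  rw [dvd_iff_normalizedFactors_le_normalizedFactors hl3 hz', normalizedFactors_pow,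
    Multiset.le_iff_count]
  intro P
  rw [Multiset.count_nsmul]
  by_cases hP : P ∈ normalizedFactors (span {l})
  · have hPprime : Prime P := prime_of_normalized_factor P hP
    have hP0 : P ≠ ⊥ := hPprime.ne_zero
    haveI hPp : P.IsPrime := Ideal.isPrime_of_prime hPprime
    haveI : P.IsMaximal := hPp.isMaximal hP0
    have hlP : l ∈ P := by
      have : P ∣ span {l} := dvd_of_mem_normalizedFactors hP
      exact Ideal.dvd_span_singleton.mp this
    -- `count P (l) ≤ 1` since `l ∉ P²`
    have hc1 : Multiset.count P (normalizedFactors (span {l})) ≤ 1 := by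
      by_contra hc
      push Not at hc
      have hrep := Multiset.le_count_iff_replicate_le.mp hc
      have hdvd := Multiset.prod_dvd_prod_of_le hrep
      rw [Multiset.prod_replicate] at hdvd
      have : P ^ 2 ∣ span {l} := hdvd.trans (prod_normalizedFactors hl').dvd
      exact hsq P (Ideal.dvd_span_singleton.mp this)
    -- `3 ≤ count P (z)` since `z ∈ P³`
    have hc3 : 3 ≤ Multiset.count P (normalizedFactors (span {z})) := by
      have h3 : P ^ 3 ∣ span {z} := Ideal.dvd_span_singleton.mpr (hz P hlP)
      have := (pow_dvd_iff_le_emultiplicity).mp h3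
      rw [emultiplicity_eq_count_normalizedFactors hPprime.irreducible hz', normalize_eq] at this
      exact_mod_cast this
    omega
  · simp [Multiset.count_eq_zero_of_notMem hP]

/-! ### The unit `ε` and `λ`, `√d₀` as algebraic integers -/

/-- In a number field `M` containing `λ` (`λ² = −3`) and `δ` (`δ² = −d`), with `3d = d₀c₀²` and
`a² − d₀b² = 4n`, `n = ±1`: the elements `λ`, `ε = a/2 + (b/2c₀)δλ = (a + b√d₀)/2` and
`√d₀ = δλ/c₀` are algebraic integers, `ε` is a unit of `𝓞_M`. [folklore] -/
theorem exists_ringOfIntegers_eps {M : Type*} [Field M] [NumberField M] {lamM δM : M}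
    (hlam : lamM ^ 2 = -3) {d : ℕ} (hδ : δM ^ 2 = -(d : M)) {a b c₀ : ℕ} {n : ℤ}
    (hn : n = 1 ∨ n = -1) (hab : (a:ℤ) ^ 2 - (mirrorRadicand d : ℤ) * (b:ℤ) ^ 2 = 4 * n)
    (hc₀0 : c₀ ≠ 0) (hc₀ : 3 * d = mirrorRadicand d * c₀ ^ 2) :
    ∃ lamO epsO sO : 𝓞 M, lamO ^ 2 = -3 ∧ IsUnit epsO ∧ sO ^ 2 = (mirrorRadicand d : 𝓞 M) ∧
      (lamO : M) = lamM ∧ (epsO : M) = (a : M) / 2 + (b : M) / (2 * c₀) * δM * lamM ∧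
      (sO : M) = δM * lamM / c₀ := by
  set d₀ := mirrorRadicand d with hd₀
  have hc₀M : (c₀ : M) ≠ 0 := Nat.cast_ne_zero.mpr hc₀0
  have h3d : (3 * d : M) = d₀ * (c₀ : M) ^ 2 := by exact_mod_cast hc₀
  have habM : (a : M) ^ 2 - d₀ * (b : M) ^ 2 = 4 * n := by exact_mod_cast hab
  set sM : M := δM * lamM / c₀ with hsM
  have hs2 : sM ^ 2 = d₀ := by
    rw [hsM, div_pow, mul_pow, hδ, hlam, div_eq_iff (pow_ne_zero 2 hc₀M)]
    linear_combination h3d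
  set εM : M := (a : M) / 2 + (b : M) / (2 * c₀) * δM * lamM with hεM
  set εbM : M := (a : M) / 2 - (b : M) / (2 * c₀) * δM * lamM with hεbM
  have h2ε : 2 * εM = a + b * sM := by rw [hεM, hsM]; field_simp
  have h2εb : 2 * εbM = a - b * sM := by rw [hεbM, hsM]; field_simp
  have hεεb : εM * εbM = n := by
    linear_combination (1 / 4 : M) * ((2 * εbM) * h2ε + (a + b * sM) * h2εb - (b : M) ^ 2 * hs2 + habM)
  have hεint : IsIntegral ℤ εM := isIntegral_of_quadratic (a := a) (n := n) (by
    push_cast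
    linear_combination (1 / 4 : M) * ((2 * εM - a + b * sM) * h2ε + (b : M) ^ 2 * hs2 - habM))
  have hεbint : IsIntegral ℤ εbM := isIntegral_of_quadratic (a := a) (n := n) (by
    push_cast
    linear_combination (1 / 4 : M) * ((2 * εbM - a - b * sM) * h2εb + (b : M) ^ 2 * hs2 - habM))
  have hlamint : IsIntegral ℤ lamM :=
    Quadratic.isIntegral_of_sq_eq_intCast (n := -3) (by rw [hlam]; norm_num)
  have hsint : IsIntegral ℤ sM :=
    Quadratic.isIntegral_of_sq_eq_intCast (n := d₀) (by rw [hs2]; norm_num)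
  refine ⟨⟨lamM, hlamint⟩, ⟨εM, hεint⟩, ⟨sM, hsint⟩, RingOfIntegers.ext (by
    simp only [map_pow, map_neg, map_ofNat]; exact hlam), ?_, RingOfIntegers.ext (by
    simp only [map_pow, map_natCast]; exact hs2), rfl, rfl, rfl⟩
  refine IsUnit.of_mul_eq_one ((n : 𝓞 M) * ⟨εbM, hεbint⟩) (RingOfIntegers.ext ?_)
  have h1 : (algebraMap (𝓞 M) M) ⟨εM, hεint⟩ = εM := rfl
  have h2 : (algebraMap (𝓞 M) M) ⟨εbM, hεbint⟩ = εbM := rfl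
  simp only [map_mul, map_one, map_intCast]
  rw [h1, h2, mul_left_comm, hεεb]
  rcases hn with rfl | rfl <;> norm_num

/-- A quadratic extension is generated (as an algebra) by any element outside the base field.
[folklore] -/
theorem algebra_adjoin_eq_top_of_finrank_two {F E : Type*} [Field F] [Field E] [Algebra F E]
    (h2 : finrank F E = 2) {θ : E} (hθ : θ ∉ Set.range (algebraMap F E)) :
    Algebra.adjoin F {θ} = ⊤ := by
  rw [eq_top_iff]
  intro x _
  obtain ⟨u, v, rfl⟩ := Quadratic.exists_eq_add_mul h2 hθ x
  exact add_mem (Subalgebra.algebraMap_mem _ u)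
    (Subalgebra.mul_mem _ (Subalgebra.algebraMap_mem _ v) (Algebra.subset_adjoin rfl))

/-! ### The tail of direction (ii) -/

/-- **Hecke's necessary condition ⇒ `UnitCubeAtThree`.**  In the setting of the file header: if
`y³ = ε` in a number field `N ⊇ M` all of whose primes are unramified over `𝓞_M`, then
`UnitCubeAtThree d` holds (`ε⁸ ≡ 1 (mod λ³𝓞_M)`, translated by
`unitCubeAtThree_of_pow_eight_sub_one_eq`). [cite: Hecke1981, §39 Thm. 119]
[cite: Washington1997, Thm 10.10 (proof)] -/
theorem unitCubeAtThree_of_isUnramifiedAt {K : Type*} [Field K] [NumberField K]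
    (h2 : finrank ℚ K = 2) {δ : K} (hδ : δ ∉ Set.range (algebraMap ℚ K)) {d : ℕ}
    (hδ2 : δ ^ 2 = -(d : K))
    (hd : ((-(d:ℤ)) % 4 = 1 ∧ Squarefree (-(d:ℤ)) ∧ (-(d:ℤ)) ≠ 1) ∨
      (4 ∣ (-(d:ℤ)) ∧ ((-(d:ℤ)) / 4 % 4 = 2 ∨ (-(d:ℤ)) / 4 % 4 = 3) ∧ Squarefree ((-(d:ℤ)) / 4)))
    (h3 : d ≠ 3) {a b : ℕ} (hunit : IsMirrorFundUnit d a b) {c₀ : ℕ} (hc₀0 : c₀ ≠ 0)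
    (hc₀ : 3 * d = mirrorRadicand d * c₀ ^ 2)
    {M : Type*} [Field M] [NumberField M] [Algebra K M] (hKM : finrank K M = 2)
    {lamM : M} (hlam : lamM ^ 2 = -3)
    {N : Type*} [Field N] [NumberField N] [Algebra M N] {y : N}
    (hy : y ^ 3 = algebraMap M N ((a : M) / 2 + (b : M) / (2 * c₀) * algebraMap K M δ * lamM))
    (hunr : ∀ (𝔔 : Ideal (𝓞 N)) [𝔔.IsMaximal], Algebra.IsUnramifiedAt (𝓞 M) 𝔔) :
    UnitCubeAtThree d := by
  classical
  -- arithmetic data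
  obtain ⟨hb, hab', hmin⟩ := hunit
  obtain ⟨n, hn, hab⟩ : ∃ n : ℤ, (n = 1 ∨ n = -1) ∧
      (a:ℤ) ^ 2 - (mirrorRadicand d : ℤ) * (b:ℤ) ^ 2 = 4 * n := by
    rcases hab' with h | h
    · exact ⟨1, Or.inl rfl, by rw [h]; norm_num⟩
    · exact ⟨-1, Or.inr rfl, by rw [h]; norm_num⟩
  have hδM : (algebraMap K M δ) ^ 2 = -(d : M) := by rw [← map_pow, hδ2, map_neg, map_natCast]
  have hlamK : ∀ x : K, algebraMap K M x ≠ lamM := algebraMap_ne_lam h2 hδ hδ2 hd h3 hlam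
  have hlamK' : lamM ∉ Set.range (algebraMap K M) := by
    rintro ⟨x, hx⟩; exact hlamK x hx
  have hc₀M : (c₀ : M) ≠ 0 := Nat.cast_ne_zero.mpr hc₀0
  have hδ0 : algebraMap K M δ ≠ 0 := by
    rw [_root_.map_ne_zero]; exact Quadratic.ne_zero_of_not_mem_range hδ
  -- integral data in `𝓞_M`
  obtain ⟨lamO, epsO, sO, hlamO, hεunit, hsO2, hlamOM, hepsOM, hsOM⟩ :=
    exists_ringOfIntegers_eps (M := M) hlam hδM hn hab hc₀0 hc₀
  -- `y ∈ 𝓞_N`, `y³ = ε`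
  have hyint : IsIntegral ℤ y := by
    refine IsIntegral.of_pow three_pos ?_
    rw [hy, ← hepsOM]
    exact (RingOfIntegers.isIntegral_coe epsO).algebraMap
  set yO : 𝓞 N := ⟨y, hyint⟩ with hyOdef
  have hyO : yO ^ 3 = algebraMap (𝓞 M) (𝓞 N) epsO := by
    apply RingOfIntegers.ext
    have e1 : ((yO ^ 3 : 𝓞 N) : N) = y ^ 3 := by
      show algebraMap (𝓞 N) N (yO ^ 3) = y ^ 3
      rw [map_pow]
      rfl
    have e2 : ((algebraMap (𝓞 M) (𝓞 N) epsO : 𝓞 N) : N) = algebraMap M N (epsO : M) := by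
      show algebraMap (𝓞 N) N (algebraMap (𝓞 M) (𝓞 N) epsO) = _
      rw [← IsScalarTower.algebraMap_apply (𝓞 M) (𝓞 N) N,
        IsScalarTower.algebraMap_apply (𝓞 M) M N, ← RingOfIntegers.coe_eq_algebraMap]
    rw [e1, e2, hepsOM, hy]
  -- Hecke: `ε⁸ ≡ 1 (mod 𝔓³)` for every prime `𝔓 ∋ λ` of `𝓞_M`
  have hcong : ∀ (𝔓 : Ideal (𝓞 M)) [𝔓.IsMaximal], lamO ∈ 𝔓 → epsO ^ 8 - 1 ∈ 𝔓 ^ 3 := by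
    intro 𝔓 _ hlamP
    have h3P2 : (3 : 𝓞 M) ∈ 𝔓 ^ 2 := by
      have : lamO ^ 2 ∈ 𝔓 ^ 2 := Ideal.pow_mem_pow hlamP 2
      rw [hlamO] at this
      simpa using (𝔓 ^ 2).neg_mem this
    have h𝔓0 : 𝔓 ≠ ⊥ := fun h => by
      rw [h] at hlamP
      rw [Ideal.mem_bot] at hlamP
      rw [hlamP] at hlamO
      norm_num at hlamO
    obtain ⟨𝔔, h𝔔max, h𝔔over⟩ : ∃ Q : Ideal (𝓞 N), Q.IsMaximal ∧ Q.LiesOver 𝔓 :=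
      Ideal.exists_maximal_ideal_liesOver_of_isIntegral 𝔓
    haveI := h𝔔max
    haveI := h𝔔over
    haveI := hunr 𝔔
    obtain ⟨ξ, hξ⟩ := exists_sub_pow_three_mem_pow_three_of_isUnramifiedAt hyO 𝔓 h3P2 𝔔
    have hεP : epsO ∉ 𝔓 := fun h =>
      (‹𝔓.IsMaximal›.ne_top (Ideal.eq_top_of_isUnit_mem _ h hεunit)).elim
    haveI : Finite (𝓞 M ⧸ 𝔓) := Ideal.finiteQuotientOfFreeOfNeBot 𝔓 h𝔓0
    have hq := pow_sub_one_sub_one_mem_pow_three 𝔓 h3P2 hεP hξ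
    rcases natCard_quot_eq_three_or_nine h2 hKM 𝔓 h3P2 with hq3 | hq9
    · rw [hq3] at hq
      have : epsO ^ 8 - 1 = (epsO ^ (3 - 1) - 1) * (epsO ^ 6 + epsO ^ 4 + epsO ^ 2 + 1) := by ring
      rw [this]
      exact Ideal.mul_mem_right _ _ hq
    · rw [hq9] at hq
      exact hq
  -- `3` has ramification index exactly `2` in `M`: one layer of `ℚ ⊆ K ⊆ M` is unramified at `3`
  have hR : ∀ (𝔓 : Ideal (𝓞 M)) [𝔓.IsMaximal], (3 : 𝓞 M) ∈ 𝔓 → (3 : 𝓞 M) ∉ 𝔓 ^ 3 := by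
    intro 𝔓 _ h3P
    refine three_not_mem_pow_three h2 hKM ?_ 𝔓 h3P
    by_cases h3d : 3 ∣ d
    · -- `M = K(√d₀)`, `3 ∤ d₀`: `M/K` is unramified above `3`
      right
      intro 𝔓' _ h3P'
      have hsK : (sO : M) ∉ Set.range (algebraMap K M) := by
        rintro ⟨x, hx⟩
        apply hlamK (x * (c₀ : K) * δ⁻¹)
        rw [map_mul, map_mul, hx, hsOM, map_inv₀, map_natCast]
        field_simp
      have hgen : Algebra.adjoin K {(sO : M)} = ⊤ := algebra_adjoin_eq_top_of_finrank_two hKM hsK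
      have hx : sO ^ 2 = algebraMap (𝓞 K) (𝓞 M) (mirrorRadicand d : 𝓞 K) := by
        rw [hsO2, map_natCast]
      refine isUnramifiedAt_of_sq_eq hx hgen 𝔓' fun hmem => ?_
      haveI : 𝔓'.IsPrime := Ideal.IsMaximal.isPrime inferInstance
      have h4 : ((4 * mirrorRadicand d : ℕ) : 𝓞 M) ∈ 𝔓' := by
        rw [map_mul, map_ofNat, map_natCast] at hmem
        exact_mod_cast hmem
      have : ((4 * mirrorRadicand d : ℕ) : ℤ) ∈ 𝔓'.under ℤ := by
        rw [Ideal.under_def, Ideal.mem_comap, map_natCast]; exact h4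
      rw [under_int_eq_span_three 𝔓' h3P', Ideal.mem_span_singleton] at this
      push_cast at this
      rcases (Int.prime_three.dvd_mul).mp this with h | h
      · norm_num at h
      · exact not_three_dvd_mirrorRadicand hd h3d (by exact_mod_cast h)
    · -- `K = ℚ(δ)`, `3 ∤ d`: `K/ℚ` is unramified above `3`
      left
      intro 𝔭 _ h3𝔭
      have hδint : IsIntegral ℤ δ :=
        Quadratic.isIntegral_of_sq_eq_intCast (n := -(d:ℤ)) (by rw [hδ2]; norm_num)
      set δO : 𝓞 K := ⟨δ, hδint⟩
      have hgen : Algebra.adjoin ℚ {(δO : K)} = ⊤ := algebra_adjoin_eq_top_of_finrank_two h2 hδ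
      have hx : δO ^ 2 = ((-(d:ℤ) : ℤ) : 𝓞 K) := RingOfIntegers.ext (by
        simp only [map_pow, map_intCast]; push_cast; exact hδ2)
      refine isUnramifiedAt_int_of_sq_eq hx hgen 𝔭 fun hmem => ?_
      haveI : 𝔭.IsPrime := Ideal.IsMaximal.isPrime inferInstance
      have : (4 * -(d:ℤ) : ℤ) ∈ 𝔭.under ℤ := by
        rw [Ideal.under_def, Ideal.mem_comap, eq_intCast]; exact hmem
      rw [under_int_eq_span_three 𝔭 h3𝔭, Ideal.mem_span_singleton, mul_neg, dvd_neg] at this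
      have h3d' : (3 : ℤ) ∣ (d : ℤ) := by
        rcases (Int.prime_three.dvd_mul).mp this with h | h
        · norm_num at h
        · exact h
      exact h3d (by exact_mod_cast h3d')
  have hsqfree : ∀ (𝔓 : Ideal (𝓞 M)) [𝔓.IsMaximal], lamO ∉ 𝔓 ^ 2 := by
    intro 𝔓 _ h
    have h4 : lamO ^ 2 ∈ (𝔓 ^ 2) ^ 2 := Ideal.pow_mem_pow h 2
    rw [hlamO, ← pow_mul] at h4
    have h3P4 : (3 : 𝓞 M) ∈ 𝔓 ^ 4 := by simpa using (𝔓 ^ (2 * 2)).neg_mem h4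
    have h3P : (3 : 𝓞 M) ∈ 𝔓 := Ideal.pow_le_self (by norm_num) h3P4
    exact hR 𝔓 h3P (Ideal.pow_le_pow_right (by norm_num : 3 ≤ 4) h3P4)
  -- globalise: `ε⁸ − 1 = λ³ w`
  have hlamO0 : lamO ≠ 0 := fun h => by rw [h] at hlamO; norm_num at hlamO
  obtain ⟨wO, hw⟩ := exists_eq_pow_three_mul hlamO0 hsqfree fun 𝔓 _ hlamP => hcong 𝔓 hlamP
  -- the conjugation `λ ↦ −λ` of `M/K`, and the translation into `UnitCubeAtThree`
  have hlamc : lamM ^ 2 = algebraMap K M (-3) := by rw [hlam, map_neg, map_ofNat]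
  let τ : M →ₐ[K] M := Quadratic.conj hKM hlamK' hlamc
  refine unitCubeAtThree_of_pow_eight_sub_one_eq hlam hδM τ.toRingHom
    (Quadratic.conj_gen hKM hlamK' hlamc) (Quadratic.conj_algebraMap hKM hlamK' hlamc δ) hd
    ⟨hb, hab', hmin⟩ hc₀0 hc₀ (RingOfIntegers.isIntegral_coe wO) ?_
  have := congrArg (algebraMap (𝓞 M) M) hw
  rw [map_sub, map_pow, map_one, map_mul, map_pow, ← RingOfIntegers.coe_eq_algebraMap,
    ← RingOfIntegers.coe_eq_algebraMap, ← RingOfIntegers.coe_eq_algebraMap, hepsOM, hlamOM] at this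
  exact this

end ScholzHecke

end Literature.NumberTheory.QuadraticFields

end
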